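import Summits.HodgeConjecture.CorCM.IrreducibleOddWeightsOrbitBalanceFamilies
import Literature.NumberTheory.ComplexMultiplication.PartialConjugationOfRealIntersection
import Literature.NumberTheory.NumberFields.ComplexAutomorphismsFixingIntersection
import Literature.AlgebraicGeometry.Pohlmann1968.CMTypeRankCharactersNumberField
import Literature.NumberTheory.ComplexMultiplication.CommonAbelianCMSubfieldDegenerate
import HarnessLib

/-!
# ORBIT BALANCE for CM fields: a GALOIS PIVOT `M ⊆ K_i` over which `Φ_i` is equidistributed makes `A_i` transparent to
# every partner whose field of definition (resp. Galois closure) meets that of `A_i` inside `M`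

COR-CM (cell `pub-hodgecm2`, binder seat `b16` gen 62, count-neutral claim ORBIT BALANCE, file O3 — CM fields,
`G = Aut(ℂ)` on `Hom(K_i, ℂ)`; theorems only, no definition, no named fact, no `sorry`).  NEW as stated, hence under
`Summits/`.  HONEST FRAMING: unconditional statements about `dim MT(∏_i A_i)` for CM abelian varieties `A_i` with CM by
`(K_i, Φ_i)`; `HC_CM` is neither used nor asserted.

THE GALOIS PIVOT.  `M` a number field NORMAL over `ℚ` (imaginary quadratic, biquadratic, cyclotomic, …) with an embedding
`jM : M → K_i`, and `Φ_i` EQUIDISTRIBUTED over `M`: every complex embedding `z` of `M` has exactly `[K_i : M]/2`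
extensions in `Φ_i` — `2·#{t ∈ Φ_i | t ∘ jM = z} = #{t | t ∘ jM = z}`, the ZERO SHADOW of this seat's gen 49
(`CommonCMSubfieldCapacity`); for an imaginary quadratic `M = k`: signature defect zero, i.e. `Φ_i` of Weil type
relative to `k`; automatic when `M` is totally real.  Since all embeddings of `M` have the same image `z₀(M) ⊂ ℂ`, the
automorphisms of `ℂ` fixing `z₀(M)` pointwise permute `Hom(K_i, ℂ)` with orbits = the fibres of `t ↦ t ∘ jM` (§1), along
which the type vector `u_1(Φ_i)` sums to zero.  Files O1/O2 then give:

* §2 PAIRS, reflex level — **`cmFamilyRank_add_card_eq_of_fixingFields_inf_le_pivot`**: fields of definition `E₀`, `E₁`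
  of `Φ_{i₀}`, `Φ_{i₁}` (`Aut(ℂ/E_k)` stabilises `Φ_{i_k}`: e.g. the reflex fields, the Galois closures), a Galois pivot
  `M ⊆ K_{i₀}` with `Φ_{i₀}` equidistributed over `M`, and `E₀ ∩ E₁ ⊆ z₀(M)` ⟹ `rank(Φ₀, Φ₁) + 2 = rank Φ₀ + rank Φ₁ + 1`
  (`Hg(A₀ × A₁) = Hg(A₀) × Hg(A₁)`); `isNondegenerateFamily_iff_forall_of_fixingFields_inf_le_pivot`.  (By
  `Literature/…/ComplexAutomorphismsFixingIntersection`, `Aut(ℂ/z₀(M)) ≤ Aut(ℂ/E₀ ∩ E₁) = ⟨Aut(ℂ/E₀), Aut(ℂ/E₁)⟩ ≤ ⟨S₀, S₁⟩`.)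
  Gen 42's `…_of_fixingFields_inf_real` asked `E₀ ∩ E₁` to be REAL; here it may be a CM field inside `M`.
* §3 FAMILIES, closure level — **`cmFamilyRank_add_card_eq_of_pairwise_pivot`**: if for every pair `i ≠ j` one of the
  two slots, say `i`, carries a Galois pivot `M ⊆ K_i` with `Φ_i` equidistributed over `M` and `L_i ∩ L_j ⊆ z₀(M)`
  (`L_k = normalClosure ℚ K_k ℂ` the Galois closures), then `Hg(∏_i A_i) = ∏_i Hg(A_i)` for the WHOLE family;
  `isNondegenerateFamily_iff_forall_of_pairwise_pivot`.  (The `Aut(ℂ/L_j)`-orbits on `Hom(K_i, ℂ)` are the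
  `Aut(ℂ/L_i ∩ L_j)`-orbits by the gluing lemma of `PartialConjugationOfRealIntersection`, hence unions of `M`-fibres.)
* §4 NAMED INSTANCES — **`cmFamilyRank_add_card_eq_pair_of_shadow_eq_zero`**: `K_{i₁}` ITSELF normal and embedded in
  `K_{i₀}` (`j : K_{i₁} → K_{i₀}`) with `Φ_{i₀}` equidistributed over it ⟹ `Hg(A₀ × A₁) = Hg(A₀) × Hg(A₁)` WHATEVER
  `Φ_{i₁}`; in particular (`K_{i₁} = k` imaginary quadratic) **`Hg(A × E_k) = Hg(A) × Hg(E_k)` for every CM abelian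
  variety `A` whose type has signature defect zero on `k ⊆ K_A`** — the positive complement of the tree's
  `SharedImaginaryQuadraticDegenerate` (non-zero defect ⟹ non-additive) and `CommonAbelianCMSubfieldDegenerate`
  (nondegenerate members over a common abelian CM subfield ⟹ non-additive; an equidistributed member is degenerate by
  Yanai's theorem but does not interact).

## References

* [Gordon1999HodgeAVSurvey] B. B. Gordon, *A survey of the Hodge conjecture for abelian varieties*, §3 Theorem (proof),
  7.5–7.7, 9.4.3 (Yanai).
* [Shimura1998] G. Shimura, *Abelian Varieties with Complex Multiplication and Modular Functions*, §8.1, §8.3, §18.2.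
* [Lang2002] S. Lang, *Algebra*, 3rd ed., VI §1 Thm. 1.1, Cor. 1.6, Thm. 1.14; V §2 Thm. 2.8.
* [Deligne1982HodgeCycles] P. Deligne, *Hodge cycles on abelian varieties*, LNM 900 (1982), I Ex. 3.7, §4 (Weil type).
* [MoonenZarhin1999LowDim] B. Moonen, Yu. Zarhin, Math. Ann. 315 (1999), §3 (3.1).
-/

set_option autoImplicit false

noncomputable section

open scoped BigOperators Classical

open NumberField IntermediateField

namespace Summit.HodgeConjecture.CorCM

open Literature.NumberTheory.ComplexMultiplication
open Literature.NumberTheory.NumberFields (mem_closure_fixing_union_of_apply_eq)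
open Literature.AlgebraicGeometry.Motives (CMType)
open Literature.AlgebraicGeometry.Pohlmann1968

/-! ### §1 The Galois pivot: automorphisms fixing `z₀(M)` have the `M`-fibres as orbits -/

section Pivot

variable {M : Type} [Field M] {K : Type} [Field K]

/-- For `M` normal over `ℚ` all complex embeddings have the same image: `z(M) ⊆ z₀(M)`. [cite: Shimura1998, §8.1] -/
theorem apply_mem_range_of_normal [NumberField M] [Normal ℚ M] (z₀ z : M →+* ℂ) (m : M) : z m ∈ Set.range z₀ := by
  obtain ⟨γ, hγ⟩ := exists_algEquiv_comp_eq z₀ z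
  exact ⟨γ m, hγ m⟩

/-- An automorphism of `ℂ` fixing `z₀(M)` pointwise does not move the restriction of an embedding of `K ⊇ M` to `M`.
[cite: Shimura1998, §8.1] -/
theorem comp_smul_eq_comp_of_apply_eq [NumberField M] [Normal ℚ M] (jM : M →+* K) (z₀ : M →+* ℂ) {g : ℂ ≃+* ℂ}
    (hg : ∀ m : M, g (z₀ m) = z₀ m) (t : K →+* ℂ) : (g • t).comp jM = t.comp jM := by
  refine RingHom.ext fun m => ?_
  change g (t (jM m)) = t (jM m)
  obtain ⟨m', hm'⟩ := apply_mem_range_of_normal z₀ (t.comp jM) m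
  change z₀ m' = t (jM m) at hm'
  rw [← hm', hg]

/-- Two embeddings of `K` with the same restriction to the normal subfield `M` differ by an automorphism of `ℂ` fixing
`z₀(M)` pointwise (transitivity of `Aut(ℂ)` on `Hom(K, ℂ)`). [cite: Shimura1998, §8.1] [cite: Lang2002, V §2 Thm. 2.8] -/
theorem exists_smul_eq_of_comp_eq [NumberField M] [Normal ℚ M] [NumberField K] (jM : M →+* K) (z₀ : M →+* ℂ) {t t' : K →+* ℂ}
    (h : t'.comp jM = t.comp jM) : ∃ g : ℂ ≃+* ℂ, (∀ m : M, g (z₀ m) = z₀ m) ∧ g • t = t' := by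
  haveI := isPretransitive_ringEquiv_complex (K := K)
  obtain ⟨g, hg⟩ := MulAction.exists_smul_eq (ℂ ≃+* ℂ) t t'
  refine ⟨g, fun m => ?_, hg⟩
  obtain ⟨m', hm'⟩ := apply_mem_range_of_normal (t.comp jM) z₀ m
  change t (jM m') = z₀ m at hm'
  rw [← hm']
  change (((g : ℂ ≃+* ℂ) : ℂ →+* ℂ).comp t) (jM m') = t (jM m')
  have := congrArg (fun f : K →+* ℂ => f (jM m')) hg
  change (((g : ℂ ≃+* ℂ) : ℂ →+* ℂ).comp t) (jM m') = t' (jM m') at this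
  rw [this]
  exact RingHom.congr_fun h m'

/-- **The orbits of the automorphisms fixing `z₀(M)` are the `M`-fibres**: for every subgroup `H` of `Aut(ℂ)` consisting of
EXACTLY the automorphisms fixing `z₀(M)` pointwise, `t' ∈ H·t ⟺ t' ∘ jM = t ∘ jM`. [cite: Shimura1998, §8.1] -/
theorem mem_orbit_iff_comp_eq_of_pivot [NumberField M] [Normal ℚ M] [NumberField K] (jM : M →+* K) (z₀ : M →+* ℂ) (H : Subgroup (ℂ ≃+* ℂ))
    (hH : ∀ g : ℂ ≃+* ℂ, g ∈ H ↔ ∀ m : M, g (z₀ m) = z₀ m) (t t' : K →+* ℂ) :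
    t' ∈ MulAction.orbit H t ↔ t'.comp jM = t.comp jM := by
  constructor
  · rintro ⟨⟨g, hg⟩, rfl⟩
    exact comp_smul_eq_comp_of_apply_eq jM z₀ ((hH g).1 hg) t
  · intro h
    obtain ⟨g, hg, hgt⟩ := exists_smul_eq_of_comp_eq jM z₀ h
    exact ⟨⟨g, (hH g).2 hg⟩, hgt⟩

/-- **Zero shadow ⟹ vanishing orbit sums.**  If `Φ` is equidistributed over `M` (`2·#{t ∈ Φ | t ∘ jM = z} = #{t | t ∘ jM = z}`
for every `z`), the type vector `u_1(Φ) = 2·𝟙_Φ − 1` sums to zero over every orbit of any subgroup `H` whose orbits are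
unions of `M`-fibres. [cite: Gordon1999HodgeAVSurvey, 9.4.3] -/
theorem orbit_sums_eq_zero_of_shadow_eq_zero [NumberField K] (jM : M →+* K) (Φ : CMType K)
    (hbal : ∀ z : M →+* ℂ, 2 * (Finset.univ.filter fun t : K →+* ℂ => t.comp jM = z ∧ t ∈ Φ.1).card =
      (Finset.univ.filter fun t : K →+* ℂ => t.comp jM = z).card)
    (H : Subgroup (ℂ ≃+* ℂ))
    (hH : ∀ t t' : K →+* ℂ, t ∈ MulAction.orbit H t' → ∀ t'' : K →+* ℂ, t''.comp jM = t.comp jM →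
      t'' ∈ MulAction.orbit H t') (x : K →+* ℂ) :
    ∃ s : Finset (K →+* ℂ), (∀ y, y ∈ s ↔ y ∈ MulAction.orbit H x) ∧
      ∑ y ∈ s, antiVec Φ.1 (1 : ℂ ≃+* ℂ) y = 0 := by
  refine ⟨Finset.univ.filter fun y => y ∈ MulAction.orbit H x, fun y => by simp, ?_⟩
  set s : Finset (K →+* ℂ) := Finset.univ.filter fun y => y ∈ MulAction.orbit H x with hs
  -- split the orbit along the values of `y ∘ jM`
  rw [← Finset.sum_fiberwise_of_maps_to (s := s) (t := s.image fun y => y.comp jM) (g := fun y => y.comp jM)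
    (fun y hy => Finset.mem_image_of_mem _ hy)]
  refine Finset.sum_eq_zero fun z hz => ?_
  obtain ⟨y₀, hy₀, rfl⟩ := Finset.mem_image.1 hz
  have hy₀' : y₀ ∈ MulAction.orbit H x := (Finset.mem_filter.1 hy₀).2
  -- the fibre of `y₀ ∘ jM` inside the orbit is the whole fibre
  have hfib : (s.filter fun y => y.comp jM = y₀.comp jM) =
      Finset.univ.filter fun t : K →+* ℂ => t.comp jM = y₀.comp jM := by
    ext y
    simp only [hs, Finset.mem_filter, Finset.mem_univ, true_and]
    exact ⟨fun h => h.2, fun h => ⟨hH y₀ x hy₀' y h, h⟩⟩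
  rw [hfib]
  -- `Σ_{fibre} (2·𝟙_Φ − 1) = 2·#(fibre ∩ Φ) − #fibre = 0`
  have hsum : ∑ y ∈ Finset.univ.filter (fun t : K →+* ℂ => t.comp jM = y₀.comp jM), antiVec Φ.1 (1 : ℂ ≃+* ℂ) y =
      2 * ((Finset.univ.filter fun t : K →+* ℂ => t.comp jM = y₀.comp jM ∧ t ∈ Φ.1).card : ℚ) -
        ((Finset.univ.filter fun t : K →+* ℂ => t.comp jM = y₀.comp jM).card : ℚ) := by
    simp only [antiVec, translateInd, one_smul, Finset.sum_sub_distrib, Finset.sum_const, nsmul_eq_mul, mul_one,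
      ← Finset.mul_sum, Finset.sum_boole, Finset.filter_filter]
  rw [hsum, sub_eq_zero]
  exact_mod_cast hbal (y₀.comp jM)

end Pivot

/-! ### §2 Pairs, reflex level: fields of definition meeting inside the pivot -/

section Pairs

variable {I : Type} [Fintype I] {K : I → Type} [∀ i, Field (K i)] [∀ i, NumberField (K i)]
  [∀ i, IsCMField (K i)] {M : Type} [Field M] [NumberField M] [Normal ℚ M]

omit [∀ i, IsCMField (K i)] in
/-- `|⊔_i Hom(K_i, ℂ)| = Σ_i [K_i : ℚ]`. [folklore] -/
private theorem card_sigma_ringHom_eq_sum'' :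
    Fintype.card ((i : I) × (K i →+* ℂ)) = ∑ i, Module.finrank ℚ (K i) := by
  rw [Fintype.card_sigma]
  exact Finset.sum_congr rfl fun i _ => Embeddings.card (K i) ℂ

/-- Rank additivity makes the family nondegenerate iff every member is (`rank ≤ |E|/2 + 1` termwise).
[cite: Gordon1999HodgeAVSurvey, 7.5–7.6.1] -/
private theorem isNondegenerateFamily_iff_forall_of_add_card_eq [Nonempty I] (Φ : ∀ i, CMType (K i))
    (hsum : CMAlgebra.cmFamilyRank Φ + Fintype.card I = (∑ i, cmTypeRank (Φ i)) + 1) :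
    CMAlgebra.IsNondegenerateFamily Φ ↔ ∀ i, IsNondegenerate (Φ i) := by
  have hle : ∀ i, cmTypeRank (Φ i) ≤ Module.finrank ℚ (K i) / 2 + 1 := fun i => cmTypeRank_le (Φ i)
  have hdiv : (∑ i, Module.finrank ℚ (K i)) / 2 = ∑ i, Module.finrank ℚ (K i) / 2 := by
    rw [← card_sigma_ringHom_eq_sum'' (K := K),
      card_sigma_div_two (G := ℂ ≃+* ℂ) (E := fun i => K i →+* ℂ) (fun i => isCMTypeWith_conj (Φ i))]
    exact Finset.sum_congr rfl fun i _ => by rw [Embeddings.card (K i) ℂ]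
  have htot : ∑ j, (Module.finrank ℚ (K j) / 2 + 1) = (∑ j, Module.finrank ℚ (K j) / 2) + Fintype.card I := by
    rw [Finset.sum_add_distrib, Finset.sum_const, Finset.card_univ, smul_eq_mul, mul_one]
  have hnd : ∀ i, IsNondegenerate (Φ i) ↔ cmTypeRank (Φ i) = Module.finrank ℚ (K i) / 2 + 1 := fun i =>
    isNondegenerate_iff (Φ i)
  rw [CMAlgebra.isNondegenerateFamily_iff, hdiv]
  simp only [hnd]
  constructor
  · intro hS i
    by_contra hne
    have hlt : cmTypeRank (Φ i) < Module.finrank ℚ (K i) / 2 + 1 := lt_of_le_of_ne (hle i) hne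
    have hsum_lt : ∑ j, cmTypeRank (Φ j) < ∑ j, (Module.finrank ℚ (K j) / 2 + 1) :=
      Finset.sum_lt_sum (fun j _ => hle j) ⟨i, Finset.mem_univ i, hlt⟩
    rw [htot] at hsum_lt
    omega
  · intro hall
    have hsum_eq : ∑ j, cmTypeRank (Φ j) = ∑ j, (Module.finrank ℚ (K j) / 2 + 1) :=
      Finset.sum_congr rfl fun j _ => hall j
    rw [htot] at hsum_eq
    omega

/-- **`Hg(A₀ × A₁) = Hg(A₀) × Hg(A₁)` FROM A GALOIS PIVOT MEETING THE FIELDS OF DEFINITION.**  Two-slot family `{i₀, i₁}`;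
`E₀, E₁ ⊂ ℂ` number fields with `Aut(ℂ/E_k)` stabilising `Φ_{i_k}` (fields of definition: reflex fields, Galois closures,
…); `M` normal over `ℚ`, `jM : M → K_{i₀}`, `z₀ : M → ℂ`, with `E₀ ∩ E₁ ⊆ z₀(M)` and `Φ_{i₀}` EQUIDISTRIBUTED over `M`.  Then
`cmFamilyRank Φ + 2 = cmTypeRank Φ₀ + cmTypeRank Φ₁ + 1`: `dim MT(A₀ × A₁) − 1 = (dim MT A₀ − 1) + (dim MT A₁ − 1)`.
[cite: Gordon1999HodgeAVSurvey, §3 Theorem (proof) and 7.7] [cite: Lang2002, VI §1 Thm. 1.1 and Cor. 1.6] [cite: Shimura1998, §8.3] -/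
theorem cmFamilyRank_add_card_eq_of_fixingFields_inf_le_pivot {i₀ i₁ : I} (h01 : i₀ ≠ i₁) (hI : ∀ j, j = i₀ ∨ j = i₁)
    (Φ : ∀ i, CMType (K i)) (E₀ E₁ : IntermediateField ℚ ℂ) [FiniteDimensional ℚ E₀] [FiniteDimensional ℚ E₁]
    (hE₀ : ∀ σ : ℂ ≃+* ℂ, (∀ z : ℂ, z ∈ E₀ → σ z = z) → ∀ x : K i₀ →+* ℂ, σ • x ∈ (Φ i₀).1 ↔ x ∈ (Φ i₀).1)
    (hE₁ : ∀ σ : ℂ ≃+* ℂ, (∀ z : ℂ, z ∈ E₁ → σ z = z) → ∀ y : K i₁ →+* ℂ, σ • y ∈ (Φ i₁).1 ↔ y ∈ (Φ i₁).1)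
    (jM : M →+* K i₀) (z₀ : M →+* ℂ) (hmeet : ∀ z : ℂ, z ∈ E₀ → z ∈ E₁ → z ∈ Set.range z₀)
    (hbal : ∀ z : M →+* ℂ, 2 * (Finset.univ.filter fun t : K i₀ →+* ℂ => t.comp jM = z ∧ t ∈ (Φ i₀).1).card =
      (Finset.univ.filter fun t : K i₀ →+* ℂ => t.comp jM = z).card) :
    CMAlgebra.cmFamilyRank Φ + Fintype.card I = (∑ i, cmTypeRank (Φ i)) + 1 := by
  haveI : Nonempty I := ⟨i₀⟩
  haveI : ∀ i, Nonempty (K i →+* ℂ) := fun i => inferInstance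
  -- `H = Aut(ℂ/z₀(M))`
  let H : Subgroup (ℂ ≃+* ℂ) :=
    { carrier := {g | ∀ m : M, g (z₀ m) = z₀ m}
      mul_mem' := fun {a b} ha hb m => by
        change a (b (z₀ m)) = z₀ m
        rw [hb m, ha m]
      one_mem' := fun m => rfl
      inv_mem' := fun {a} ha m => by
        change a.symm (z₀ m) = z₀ m
        rw [RingEquiv.symm_apply_eq]
        exact (ha m).symm }
  have hHmem : ∀ g : ℂ ≃+* ℂ, g ∈ H ↔ ∀ m : M, g (z₀ m) = z₀ m := fun g => Iff.rfl
  -- `H ≤ Aut(ℂ/E₀ ∩ E₁) = ⟨Aut(ℂ/E₀), Aut(ℂ/E₁)⟩ ≤ ⟨S₀, S₁⟩`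
  have hH : H ≤ Subgroup.closure
      ({s : ℂ ≃+* ℂ | ∀ x : K i₀ →+* ℂ, s • x ∈ (Φ i₀).1 ↔ x ∈ (Φ i₀).1} ∪
        {s : ℂ ≃+* ℂ | ∀ y : K i₁ →+* ℂ, s • y ∈ (Φ i₁).1 ↔ y ∈ (Φ i₁).1}) := by
    intro g hg
    have hg' : ∀ z : ℂ, z ∈ E₀ → z ∈ E₁ → g z = z := fun z h₀ h₁ => by
      obtain ⟨m, rfl⟩ := hmeet z h₀ h₁
      exact (hHmem g).1 hg m
    exact Subgroup.closure_mono (Set.union_subset_union (fun σ hσ => hE₀ σ hσ) (fun σ hσ => hE₁ σ hσ))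
      (mem_closure_fixing_union_of_apply_eq (E₀ := E₀) (E₁ := E₁) hg')
  -- orbit balance along `H`
  have horb : ∀ x : K i₀ →+* ℂ, ∃ s : Finset (K i₀ →+* ℂ),
      (∀ y, y ∈ s ↔ y ∈ MulAction.orbit H x) ∧ ∑ y ∈ s, antiVec (Φ i₀).1 (1 : ℂ ≃+* ℂ) y = 0 :=
    orbit_sums_eq_zero_of_shadow_eq_zero jM (Φ i₀) hbal H fun t t' ht t'' ht'' => by
      rw [mem_orbit_iff_comp_eq_of_pivot jM z₀ H hHmem] at ht ⊢
      rw [ht'', ht]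
  exact IrrOdd.typeRank_sigmaType_add_card_eq_of_orbit_sums_eq_zero (G := ℂ ≃+* ℂ) (Φ := fun i => (Φ i).1)
    (fun i => isCMTypeWith_conj (Φ i)) hI h01 H hH horb

/-- **… hence the pair is nondegenerate iff both members are** (`Hg(A₀ × A₁) = Hg(A₀) × Hg(A₁)`): a Galois pivot over
which `Φ_{i₀}` is equidistributed and which contains `E₀ ∩ E₁`.
[cite: Gordon1999HodgeAVSurvey, §3 Theorem and 7.5–7.6.1] [cite: Shimura1998, §8.3] -/
theorem isNondegenerateFamily_iff_forall_of_fixingFields_inf_le_pivot {i₀ i₁ : I} (h01 : i₀ ≠ i₁)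
    (hI : ∀ j, j = i₀ ∨ j = i₁) (Φ : ∀ i, CMType (K i)) (E₀ E₁ : IntermediateField ℚ ℂ) [FiniteDimensional ℚ E₀]
    [FiniteDimensional ℚ E₁]
    (hE₀ : ∀ σ : ℂ ≃+* ℂ, (∀ z : ℂ, z ∈ E₀ → σ z = z) → ∀ x : K i₀ →+* ℂ, σ • x ∈ (Φ i₀).1 ↔ x ∈ (Φ i₀).1)
    (hE₁ : ∀ σ : ℂ ≃+* ℂ, (∀ z : ℂ, z ∈ E₁ → σ z = z) → ∀ y : K i₁ →+* ℂ, σ • y ∈ (Φ i₁).1 ↔ y ∈ (Φ i₁).1)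
    (jM : M →+* K i₀) (z₀ : M →+* ℂ) (hmeet : ∀ z : ℂ, z ∈ E₀ → z ∈ E₁ → z ∈ Set.range z₀)
    (hbal : ∀ z : M →+* ℂ, 2 * (Finset.univ.filter fun t : K i₀ →+* ℂ => t.comp jM = z ∧ t ∈ (Φ i₀).1).card =
      (Finset.univ.filter fun t : K i₀ →+* ℂ => t.comp jM = z).card) :
    CMAlgebra.IsNondegenerateFamily Φ ↔ ∀ i, IsNondegenerate (Φ i) :=
  haveI : Nonempty I := ⟨i₀⟩
  isNondegenerateFamily_iff_forall_of_add_card_eq Φ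
    (cmFamilyRank_add_card_eq_of_fixingFields_inf_le_pivot h01 hI Φ E₀ E₁ hE₀ hE₁ jM z₀ hmeet hbal)

end Pairs

/-! ### §3 Families, closure level: Galois closures meeting inside the pivot -/

section Families

variable {I : Type} [Fintype I] {K : I → Type} [∀ i, Field (K i)] [∀ i, NumberField (K i)] [∀ i, IsCMField (K i)]

omit [Fintype I] [∀ i, IsCMField (K i)] in
/-- **The `Aut(ℂ/L_j)`-orbits on `Hom(K_i, ℂ)` are unions of `M`-fibres** when the Galois closures `L_i`, `L_j` meet
inside `z₀(M)` (`M` normal, `jM : M → K_i`): for `g` fixing `z₀(M) ⊇ L_i ∩ L_j` the gluing lemma gives `τ ∈ Aut(ℂ/L_j)` with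
`τ = g` on `L_i ⊇ y(K_i)`. [cite: Lang2002, VI §1 Thm. 1.14 and V §2 Thm. 2.8] -/
theorem mem_orbit_of_comp_eq_of_normalClosure_inf_le_pivot {i j : I} {M : Type} [Field M] [NumberField M] [Normal ℚ M]
    (jM : M →+* K i) (z₀ : M →+* ℂ)
    (hmeet : ∀ z : ℂ, z ∈ normalClosure ℚ (K i) ℂ → z ∈ normalClosure ℚ (K j) ℂ → z ∈ Set.range z₀)
    (H : Subgroup (ℂ ≃+* ℂ)) (hH : ∀ g : ℂ ≃+* ℂ, (∀ z : ℂ, z ∈ normalClosure ℚ (K j) ℂ → g z = z) → g ∈ H)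
    (t t' : K i →+* ℂ) (ht : t ∈ MulAction.orbit H t') (t'' : K i →+* ℂ) (htt : t''.comp jM = t.comp jM) :
    t'' ∈ MulAction.orbit H t' := by
  haveI : ∀ l : I, @Normal ℚ ↥(normalClosure ℚ (K l) ℂ) _ _ (IntermediateField.algebra' _) :=
    normal_normalClosure_complex
  obtain ⟨g, hg, rfl⟩ := exists_smul_eq_of_comp_eq jM z₀ htt
  obtain ⟨τ, hA, hB⟩ := exists_ringEquiv_apply_eq_of_normal (A := normalClosure ℚ (K i) ℂ)
    (B := normalClosure ℚ (K j) ℂ) g (fun x h₁ h₂ => by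
      obtain ⟨m, rfl⟩ := hmeet x h₁ h₂
      exact hg m)
  have hτt : τ • t = g • t := RingHom.ext fun x => by
    rw [ringEquiv_smul_apply, ringEquiv_smul_apply]
    exact hA _ (apply_mem_normalClosure i t x)
  rw [← hτt, ← MulAction.orbit_eq_iff.2 ht]
  exact ⟨⟨τ, hH τ hB⟩, rfl⟩

/-- **`Hg(∏_i A_i) = ∏_i Hg(A_i)` FROM PAIRWISE GALOIS PIVOTS.**  CM fields `K_i`, ARBITRARY CM types `Φ_i`, Galois closures
`L_i = normalClosure ℚ K_i ℂ`.  If for every pair `i ≠ j` ONE of the two slots, say `i`, carries a number field `M` normal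
over `ℚ` with `jM : M → K_i`, `z₀ : M → ℂ`, `L_i ∩ L_j ⊆ z₀(M)` and `Φ_i` EQUIDISTRIBUTED over `M`
(`2·#{t ∈ Φ_i | t ∘ jM = z} = #{t | t ∘ jM = z}` for all `z`), then `cmFamilyRank Φ + |I| = Σ_i cmTypeRank Φ_i + 1`:
`dim MT(∏_i A_i) − 1 = Σ_i (dim MT(A_i) − 1)`.  (`M` totally real containing `L_i ∩ L_j`: gen 59 F10's real intersections.)
[cite: Gordon1999HodgeAVSurvey, §3 Theorem (proof) and 7.7] [cite: MoonenZarhin1999LowDim, §3 (3.1)] [cite: Lang2002, VI §1 Thm. 1.14] -/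
theorem cmFamilyRank_add_card_eq_of_pairwise_pivot [Nonempty I] (Φ : ∀ i, CMType (K i))
    (hpiv : ∀ i j : I, i ≠ j →
      (∃ (M : Type) (_ : Field M) (_ : NumberField M) (_ : Normal ℚ M) (jM : M →+* K i) (z₀ : M →+* ℂ),
        (∀ z : ℂ, z ∈ normalClosure ℚ (K i) ℂ → z ∈ normalClosure ℚ (K j) ℂ → z ∈ Set.range z₀) ∧
        ∀ z : M →+* ℂ, 2 * (Finset.univ.filter fun t : K i →+* ℂ => t.comp jM = z ∧ t ∈ (Φ i).1).card =
          (Finset.univ.filter fun t : K i →+* ℂ => t.comp jM = z).card) ∨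
      (∃ (M : Type) (_ : Field M) (_ : NumberField M) (_ : Normal ℚ M) (jM : M →+* K j) (z₀ : M →+* ℂ),
        (∀ z : ℂ, z ∈ normalClosure ℚ (K j) ℂ → z ∈ normalClosure ℚ (K i) ℂ → z ∈ Set.range z₀) ∧
        ∀ z : M →+* ℂ, 2 * (Finset.univ.filter fun t : K j →+* ℂ => t.comp jM = z ∧ t ∈ (Φ j).1).card =
          (Finset.univ.filter fun t : K j →+* ℂ => t.comp jM = z).card)) :
    CMAlgebra.cmFamilyRank Φ + Fintype.card I = (∑ i, cmTypeRank (Φ i)) + 1 := by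
  haveI : ∀ i, Nonempty (K i →+* ℂ) := fun i => inferInstance
  -- the kernel subgroup `Aut(ℂ/L_j)` of a slot
  have hker : ∀ j : I, ∃ H : Subgroup (ℂ ≃+* ℂ), (∀ g ∈ H, ∀ s : K j →+* ℂ, g • s = s) ∧
      ∀ g : ℂ ≃+* ℂ, (∀ z : ℂ, z ∈ normalClosure ℚ (K j) ℂ → g z = z) → g ∈ H := fun j =>
    ⟨{ carrier := {g | ∀ z : ℂ, z ∈ normalClosure ℚ (K j) ℂ → g z = z}
       mul_mem' := fun {a b} ha hb z hz => by
         change a (b z) = z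
         rw [hb z hz, ha z hz]
       one_mem' := fun z _ => rfl
       inv_mem' := fun {a} ha z hz => by
         change a.symm z = z
         rw [RingEquiv.symm_apply_eq]
         exact (ha z hz).symm },
      fun g hg s => RingHom.ext fun x => by
        rw [ringEquiv_smul_apply]
        exact hg _ (apply_mem_normalClosure j s x),
      fun g hg => hg⟩
  have key : ∀ i j : I, i ≠ j →
      (∃ (M : Type) (_ : Field M) (_ : NumberField M) (_ : Normal ℚ M) (jM : M →+* K i) (z₀ : M →+* ℂ),
        (∀ z : ℂ, z ∈ normalClosure ℚ (K i) ℂ → z ∈ normalClosure ℚ (K j) ℂ → z ∈ Set.range z₀) ∧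
        ∀ z : M →+* ℂ, 2 * (Finset.univ.filter fun t : K i →+* ℂ => t.comp jM = z ∧ t ∈ (Φ i).1).card =
          (Finset.univ.filter fun t : K i →+* ℂ => t.comp jM = z).card) →
      ∃ H : Subgroup (ℂ ≃+* ℂ), (∀ g ∈ H, ∀ s : K j →+* ℂ, g • s = s) ∧ ∀ x : K i →+* ℂ,
        ∃ s : Finset (K i →+* ℂ), (∀ y, y ∈ s ↔ y ∈ MulAction.orbit H x) ∧
          ∑ y ∈ s, antiVec (Φ i).1 (1 : ℂ ≃+* ℂ) y = 0 := by
    intro i j hij ⟨M, _, _, _, jM, z₀, hmeet, hbal⟩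
    obtain ⟨H, hHj, hHmem⟩ := hker j
    exact ⟨H, hHj, orbit_sums_eq_zero_of_shadow_eq_zero jM (Φ i) hbal H fun t t' ht t'' htt =>
      mem_orbit_of_comp_eq_of_normalClosure_inf_le_pivot jM z₀ hmeet H hHmem t t' ht t'' htt⟩
  refine (cmFamilyRank_add_card_eq_iff_finrank_eq_univ Φ).2
    (IrrOdd.finrank_antiSpan_sigmaType_eq_sum_of_pairwise_orbit_sums_eq_zero (G := ℂ ≃+* ℂ)
      (E := fun i => K i →+* ℂ) (Φ := fun i => (Φ i).1) fun i j hij => ?_)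
  rcases hpiv i j hij with h | h
  · exact Or.inl (key i j hij h)
  · exact Or.inr (key j i hij.symm h)

/-- **… and then the family is nondegenerate iff every member is.** [cite: Gordon1999HodgeAVSurvey, §3 Theorem (2) and 7.5] -/
theorem isNondegenerateFamily_iff_forall_of_pairwise_pivot [Nonempty I] (Φ : ∀ i, CMType (K i))
    (hpiv : ∀ i j : I, i ≠ j →
      (∃ (M : Type) (_ : Field M) (_ : NumberField M) (_ : Normal ℚ M) (jM : M →+* K i) (z₀ : M →+* ℂ),
        (∀ z : ℂ, z ∈ normalClosure ℚ (K i) ℂ → z ∈ normalClosure ℚ (K j) ℂ → z ∈ Set.range z₀) ∧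
        ∀ z : M →+* ℂ, 2 * (Finset.univ.filter fun t : K i →+* ℂ => t.comp jM = z ∧ t ∈ (Φ i).1).card =
          (Finset.univ.filter fun t : K i →+* ℂ => t.comp jM = z).card) ∨
      (∃ (M : Type) (_ : Field M) (_ : NumberField M) (_ : Normal ℚ M) (jM : M →+* K j) (z₀ : M →+* ℂ),
        (∀ z : ℂ, z ∈ normalClosure ℚ (K j) ℂ → z ∈ normalClosure ℚ (K i) ℂ → z ∈ Set.range z₀) ∧
        ∀ z : M →+* ℂ, 2 * (Finset.univ.filter fun t : K j →+* ℂ => t.comp jM = z ∧ t ∈ (Φ j).1).card =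
          (Finset.univ.filter fun t : K j →+* ℂ => t.comp jM = z).card)) :
    CMAlgebra.IsNondegenerateFamily Φ ↔ ∀ i, IsNondegenerate (Φ i) := by
  classical
  exact isNondegenerateFamily_iff_forall_of_add_card_eq Φ (cmFamilyRank_add_card_eq_of_pairwise_pivot Φ hpiv)

end Families

/-! ### §4 Named instances: the partner's field is the pivot -/

section Named

variable {I : Type} [Fintype I] {K : I → Type} [∀ i, Field (K i)] [∀ i, NumberField (K i)]
  [∀ i, IsCMField (K i)]

/-- **A TYPE EQUIDISTRIBUTED OVER (A COPY OF) THE PARTNER'S NORMAL FIELD NEVER INTERACTS WITH THE PARTNER.**  Two-slot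
family `{i₀, i₁}`, `K_{i₁}` normal over `ℚ` (imaginary quadratic, `ℚ(ζ_n)`, …) and embedded in `K_{i₀}` by `j`, `Φ_{i₀}`
equidistributed over `j(K_{i₁})` (every embedding of `K_{i₁}` has exactly `[K_{i₀} : K_{i₁}]/2` extensions in `Φ_{i₀}`).
Then `Hg(A₀ × A₁) = Hg(A₀) × Hg(A₁)` WHATEVER the type `Φ_{i₁}`: `cmFamilyRank Φ + 2 = cmTypeRank Φ₀ + cmTypeRank Φ₁ + 1`.
(Pivot `M = K_{i₁}`: its Galois closure in `ℂ` is `z₀(K_{i₁})`, which contains `L_{i₀} ∩ L_{i₁}`.)  The tree's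
`SharedImaginaryQuadraticDegenerate` / `CommonAbelianCMSubfieldDegenerate` are the complementary NEGATIVE statements
(non-zero defect, resp. nondegenerate members). [cite: Gordon1999HodgeAVSurvey, §3 Theorem (proof), 7.7 and 9.4.3]
[cite: Deligne1982HodgeCycles, §4] -/
theorem cmFamilyRank_add_card_eq_pair_of_shadow_eq_zero {i₀ i₁ : I} (h01 : i₀ ≠ i₁) (hI : ∀ j, j = i₀ ∨ j = i₁)
    [Normal ℚ (K i₁)] (Φ : ∀ i, CMType (K i)) (j : K i₁ →+* K i₀)
    (hbal : ∀ z : K i₁ →+* ℂ, 2 * (Finset.univ.filter fun t : K i₀ →+* ℂ => t.comp j = z ∧ t ∈ (Φ i₀).1).card =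
      (Finset.univ.filter fun t : K i₀ →+* ℂ => t.comp j = z).card) :
    CMAlgebra.cmFamilyRank Φ + Fintype.card I = (∑ i, cmTypeRank (Φ i)) + 1 := by
  haveI : Nonempty I := ⟨i₀⟩
  obtain ⟨z₀⟩ : Nonempty (K i₁ →+* ℂ) := inferInstance
  refine cmFamilyRank_add_card_eq_of_pairwise_pivot Φ fun i i' hii' => ?_
  -- the pair is `{i₀, i₁}`: put the pivot on the slot `i₀`
  have hL : ∀ z : ℂ, z ∈ normalClosure ℚ (K i₁) ℂ → z ∈ Set.range z₀ := fun z hz =>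
    normalClosure_le_range_of_normal z₀ hz
  rcases hI i with rfl | rfl <;> rcases hI i' with rfl | rfl
  · exact absurd rfl hii'
  · exact Or.inl ⟨K i', inferInstance, inferInstance, inferInstance, j, z₀, fun z _ hz => hL z hz, hbal⟩
  · exact Or.inr ⟨K i, inferInstance, inferInstance, inferInstance, j, z₀, fun z _ hz => hL z hz, hbal⟩
  · exact absurd rfl hii'

end Named

end Summit.HodgeConjecture.CorCM

end
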